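import Summits.FinalStateConjecture.FinalStateConjecture.Theorems.KerrShieldedDataExist.Negative.SliceClause
import Literature.Geometry.Lorentzian.KerrStarCoord
import HarnessLib

/-!
# `KerrShieldedDataExist`, line `plug-the-second-sheet` (skeleton v4 "KerrCap") — stub `stub_capImmersion`, I:
# the conormal `ϱ′ dt* − τ′ dr` of the cap map in the ingoing Kerr–Schild chart

Support file (`--supports stmt-FinalStateConjecture-10055`; everything proved, no definitions, no named facts)
for the registered stub `stub_capImmersion` of `Cruxes/KerrShieldedDataExist/Lines/plug_the_second_sheet.lean`.
The cap map `Ψ(u) = (τ(s), X u)`, `s = ‖u‖`, has Kerr–Schild radius `r(X u) = ϱ(s)`, so its conormal at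
`Ψ(u)` is the covector `n = p dt* − q dr`, `p = ϱ′(s) ≥ 0`, `q = τ′(s) ≥ 0`, `dr = Kerr.radiusGrad` the spatial
gradient of the Kerr–Schild radius. This file is the POINT ALGEBRA of such a covector at a point
`x = (t, y)` of the chart with `r = r(0, y) > 0`, `Σ = Kerr.blSigma a y`, `H = Mr/Σ`, for a linear functional
`n` given by the equation `n w = p w⁰ − q dr(w⃗)` (hypothesis-with-equation; no definition is introduced):

* `capConormal_nullVector`: `n(ℓ♯) = −(p + q)` (`(ℓ♯)⁰ = −1`, `dr(ℓ⃗) = 1`, `Kerr.radiusGrad_nullSpatial`);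
* `capConormal_etaSharp`: `η⁻¹(n, n) = −p² + q² (r² + a²)/Σ` (`|∇r|² = (r² + a²)/Σ`, `Kerr.inner_radiusGradVec_self`);
* `capConormal_coSharp`: **`g⁻¹(n, n) = (−Σ p² + q²(r² + a²) − 2Mr(p + q)²)/Σ`** (`g⁻¹ = η⁻¹ − 2H ℓ♯ ⊗ ℓ♯`,
  `Kerr.coSharp`), the quantity whose sign decides spacelikeness (`= −(1 + 2H)p² − 4Hpq + (Δ/Σ)q²`);
* `capConormal_timeVector`: `n(V) = p + 2H(p + q)` for `V = Kerr.timeVector = ∂_{t*} − 2Hℓ♯`;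
* `capConormal_timeVector_pos`: `n(V) > 0` for `p ≥ 0`, `p + q > 0`, `M > 0`;
* `coSharp_capConormal_eq`: the raw normal in closed form, `g♯n = (−p, −q ∇r) + 2H(p + q) ℓ♯` (`η♯n = (−p, −q∇r)`,
  `n(ℓ♯) = −(p + q)`), used for its smoothness; `bilin_coSharp_capConormal(_self)`,
  `bilin_timeVector_coSharp_capConormal`: the same identities read through `g(g♯n, ·) = n` (`Kerr.bilin_coSharp`);
* the two sign certificates of the numerator `F = −Σp² + q²(r² + a²) − 2Mr(p + q)²`:
  `capConormalNum_neg_of_delta_neg` (black-hole region `Δ(r) < 0`: all three terms of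
  `F = −(Σ + 2Mr)p² + Δ q² − 4Mr pq` are `≤ 0`, one `< 0`) and `capConormalNum_neg_of_slope` (graph zone
  `q = T′p`: `F = p²(−Σ + T′²(r²+a²) − 2Mr(1+T′)²) ≤ p² · conormalForm M a r 0 T′ < 0`, the landed certificate
  `Negative.conormalForm_bentSlope_neg`);
* `contDiffAt_radiusGradVec`: `∇r = (r² y + a² z e_z)/(rΣ)` is `C^∞` where `r > 0`.

References: Kerr–Schild 1965, §2 (`g⁻¹ = η⁻¹ − 2Hℓ♯⊗ℓ♯`); Visser arXiv:0706.0622, (32)–(35);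
Dafermos–Rodnianski arXiv:0811.0354, §5.1; O'Neill 1983, Ch. 5, Lemma 5.26.
-/

-- the doubled `FinalStateConjecture` path component is the summit/problem naming scheme, not a mistake
set_option linter.dupNamespace false

noncomputable section

open Real Set Filter
open scoped Manifold ContDiff Topology InnerProductSpace
open Literature.Geometry.Lorentzian

namespace Summit.FinalStateConjecture.FinalStateConjecture.Theorems.SwallowTheDatum

namespace KerrCap

open Summit.FinalStateConjecture.FinalStateConjecture.Theorems.KerrShieldedDataExist

/-! ### The covector `n = p dt* − q dr` at a point `(t, y)` with `r(0, y) > 0` -/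

section Conormal

variable {M a t p q : ℝ} {y : E3} {n : E4 →ₗ[ℝ] ℝ}

/-- **`n(ℓ♯) = −(p + q)`** for `n = p dt* − q dr` (`(ℓ♯)⁰ = −1`, `dr(ℓ⃗) = 1`). [cite: arXiv07060622, (34)–(35)] -/
theorem capConormal_nullVector (hn : ∀ w, n w = p * w 0 - q * Kerr.radiusGrad a y (E4.spatial w))
    (hr : 0 < Kerr.radius a (E4.ofTimeSpace 0 y)) :
    n (Kerr.nullVector a (E4.ofTimeSpace t y)) = -(p + q) := by
  have h1 : E4.spatial (Kerr.nullVector a (E4.ofTimeSpace t y)) = Kerr.nullSpatial a (E4.ofTimeSpace t y) :=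
    rfl
  rw [hn, Kerr.nullVector_apply_zero, h1, Kerr.radiusGrad_nullSpatial t hr]
  ring

/-- `n(∂_{t*}) = p`. [folklore] -/
theorem capConormal_basisVector_zero (hn : ∀ w, n w = p * w 0 - q * Kerr.radiusGrad a y (E4.spatial w)) :
    n (E4.basisVector 0) = p := by
  rw [hn, E4.spatial_basisVector_zero, map_zero]
  simp

/-- `n(∂_{i+1}) = −q (∇r)_i`. [folklore] -/
theorem capConormal_basisVector_succ (hn : ∀ w, n w = p * w 0 - q * Kerr.radiusGrad a y (E4.spatial w))
    (i : Fin 3) : n (E4.basisVector i.succ) = -(q * Kerr.radiusGradVec a y i) := by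
  rw [hn, E4.spatial_basisVector_succ, Kerr.radiusGrad_single]
  simp [Fin.succ_ne_zero]

/-- **`η⁻¹(n, n) = −p² + q² (r² + a²)/Σ`** (`|∇r|² = (r² + a²)/Σ`). [cite: arXiv07060622, (35)] -/
theorem capConormal_etaSharp (hn : ∀ w, n w = p * w 0 - q * Kerr.radiusGrad a y (E4.spatial w))
    (hr : 0 < Kerr.radius a (E4.ofTimeSpace 0 y)) :
    n (Kerr.etaSharp n) =
      -p ^ 2 + q ^ 2 * ((Kerr.radius a (E4.ofTimeSpace 0 y) ^ 2 + a ^ 2) / Kerr.blSigma a y) := by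
  rw [Kerr.apply_etaSharp, ← Kerr.inner_radiusGradVec_self hr, real_inner_self_eq_norm_sq, E3.norm_sq,
    capConormal_basisVector_zero hn, show (1 : Fin 4) = Fin.succ 0 from rfl,
    show (2 : Fin 4) = Fin.succ 1 from rfl, show (3 : Fin 4) = Fin.succ 2 from rfl,
    capConormal_basisVector_succ hn, capConormal_basisVector_succ hn, capConormal_basisVector_succ hn]
  ring

/-- **`g⁻¹(n, n) = (−Σp² + q²(r² + a²) − 2Mr(p + q)²)/Σ`** for `n = p dt* − q dr`, from
`g⁻¹ = η⁻¹ − 2H ℓ♯ ⊗ ℓ♯` (`Kerr.coSharp`), `H = Mr/Σ`, `n(ℓ♯) = −(p + q)`. Equivalently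
`g⁻¹(n,n) = −(1 + 2H)p² − 4Hpq + (Δ/Σ)q²` with `g⁻¹(dt*,dt*) = −1 − 2H`, `g⁻¹(dt*,dr) = 2H`, `g⁻¹(dr,dr) = Δ/Σ`.
[cite: KerrSchild1965, §2] [cite: arXiv07060622, (32)–(35)] -/
theorem capConormal_coSharp (hn : ∀ w, n w = p * w 0 - q * Kerr.radiusGrad a y (E4.spatial w))
    (hr : 0 < Kerr.radius a (E4.ofTimeSpace 0 y)) :
    n (Kerr.coSharp M a (E4.ofTimeSpace t y) n) =
      (-Kerr.blSigma a y * p ^ 2 + q ^ 2 * (Kerr.radius a (E4.ofTimeSpace 0 y) ^ 2 + a ^ 2) -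
          2 * M * Kerr.radius a (E4.ofTimeSpace 0 y) * (p + q) ^ 2) / Kerr.blSigma a y := by
  have hS := Kerr.blSigma_pos hr
  rw [Kerr.coSharp, map_sub, map_smul, capConormal_etaSharp hn hr, capConormal_nullVector hn hr,
    Kerr.scalarH_ofTimeSpace_eq t hr, smul_eq_mul]
  field_simp

/-- **`n(V) = p + 2H(p + q)`** for the Kerr–Schild orienting field `V = ∂_{t*} − 2Hℓ♯`. [cite: arXiv08110354, §5.1] -/
theorem capConormal_timeVector (hn : ∀ w, n w = p * w 0 - q * Kerr.radiusGrad a y (E4.spatial w))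
    (hr : 0 < Kerr.radius a (E4.ofTimeSpace 0 y)) :
    n (Kerr.timeVector M a (E4.ofTimeSpace t y)) =
      p + 2 * Kerr.scalarH M a (E4.ofTimeSpace t y) * (p + q) := by
  rw [Kerr.timeVector, map_sub, map_smul, capConormal_nullVector hn hr, capConormal_basisVector_zero hn,
    smul_eq_mul]
  ring

/-- `η♯n = (−p, −q∇r)` for `n = p dt* − q dr` (`η♯n = (−n₀, n₁, n₂, n₃)`). [folklore] -/
theorem etaSharp_capConormal_eq (hn : ∀ w, n w = p * w 0 - q * Kerr.radiusGrad a y (E4.spatial w)) :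
    Kerr.etaSharp n = E4.ofTimeSpace (-p) (-(q • Kerr.radiusGradVec a y)) := by
  ext μ
  refine Fin.cases ?_ (fun i ↦ ?_) μ
  · rw [Kerr.etaSharp_apply_zero, capConormal_basisVector_zero hn, E4.ofTimeSpace_apply_zero]
  · rw [E4.ofTimeSpace_apply_succ, PiLp.neg_apply, PiLp.smul_apply, smul_eq_mul,
      ← capConormal_basisVector_succ hn i]
    fin_cases i
    · exact Kerr.etaSharp_apply_one n
    · exact Kerr.etaSharp_apply_two n
    · exact Kerr.etaSharp_apply_three n

/-- **The raw normal in closed form**: `g♯n = (−p, −q∇r) + 2H(p + q) ℓ♯` for `n = p dt* − q dr`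
(`g♯ = η♯ − 2H ℓ♯ ⊗ ℓ♯`, `n(ℓ♯) = −(p + q)`). [cite: KerrSchild1965, §2] -/
theorem coSharp_capConormal_eq (hn : ∀ w, n w = p * w 0 - q * Kerr.radiusGrad a y (E4.spatial w))
    (hr : 0 < Kerr.radius a (E4.ofTimeSpace 0 y)) :
    Kerr.coSharp M a (E4.ofTimeSpace t y) n =
      E4.ofTimeSpace (-p) (-(q • Kerr.radiusGradVec a y)) +
        (2 * Kerr.scalarH M a (E4.ofTimeSpace t y) * (p + q)) • Kerr.nullVector a (E4.ofTimeSpace t y) := by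
  rw [Kerr.coSharp, etaSharp_capConormal_eq hn, capConormal_nullVector hn hr,
    show 2 * Kerr.scalarH M a (E4.ofTimeSpace t y) * -(p + q) =
      -(2 * Kerr.scalarH M a (E4.ofTimeSpace t y) * (p + q)) by ring, neg_smul, sub_neg_eq_add]

/-- `g(g♯n, w) = n(w)` at a point of the chart (`Kerr.bilin_coSharp`). [cite: KerrSchild1965, §2] -/
theorem bilin_coSharp_capConormal (hr : 0 < Kerr.radius a (E4.ofTimeSpace 0 y)) (w : E4) :
    Kerr.bilin M a (E4.ofTimeSpace t y) (Kerr.coSharp M a (E4.ofTimeSpace t y) n) w = n w :=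
  Kerr.bilin_coSharp M a (by rwa [Kerr.radius_ofTimeSpace]) n w

/-- **`g(g♯n, g♯n) = g⁻¹(n, n) = (−Σp² + q²(r² + a²) − 2Mr(p + q)²)/Σ`.** [cite: KerrSchild1965, §2] -/
theorem bilin_coSharp_capConormal_self (hn : ∀ w, n w = p * w 0 - q * Kerr.radiusGrad a y (E4.spatial w))
    (hr : 0 < Kerr.radius a (E4.ofTimeSpace 0 y)) :
    Kerr.bilin M a (E4.ofTimeSpace t y) (Kerr.coSharp M a (E4.ofTimeSpace t y) n)
        (Kerr.coSharp M a (E4.ofTimeSpace t y) n) =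
      (-Kerr.blSigma a y * p ^ 2 + q ^ 2 * (Kerr.radius a (E4.ofTimeSpace 0 y) ^ 2 + a ^ 2) -
          2 * M * Kerr.radius a (E4.ofTimeSpace 0 y) * (p + q) ^ 2) / Kerr.blSigma a y := by
  rw [bilin_coSharp_capConormal hr, capConormal_coSharp hn hr]

/-- **`g(V, g♯n) = n(V) = p + 2H(p + q)`.** [cite: arXiv08110354, §5.1] -/
theorem bilin_timeVector_coSharp_capConormal
    (hn : ∀ w, n w = p * w 0 - q * Kerr.radiusGrad a y (E4.spatial w))
    (hr : 0 < Kerr.radius a (E4.ofTimeSpace 0 y)) :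
    Kerr.bilin M a (E4.ofTimeSpace t y) (Kerr.timeVector M a (E4.ofTimeSpace t y))
        (Kerr.coSharp M a (E4.ofTimeSpace t y) n) =
      p + 2 * Kerr.scalarH M a (E4.ofTimeSpace t y) * (p + q) := by
  rw [Kerr.bilin_symm, bilin_coSharp_capConormal hr, capConormal_timeVector hn hr]

/-- `n(V) > 0` as soon as `p ≥ 0`, `p + q > 0`, `M > 0` (`H = Mr/Σ > 0`): the raw normal `g♯n` has
`g(V, g♯n) > 0`, so `−g♯n` lies in the future cone of `V`. [cite: arXiv08110354, §5.1] -/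
theorem capConormal_timeVector_pos (hn : ∀ w, n w = p * w 0 - q * Kerr.radiusGrad a y (E4.spatial w))
    (hr : 0 < Kerr.radius a (E4.ofTimeSpace 0 y)) (hM : 0 < M) (hp : 0 ≤ p) (hpq : 0 < p + q) :
    0 < n (Kerr.timeVector M a (E4.ofTimeSpace t y)) := by
  have hS := Kerr.blSigma_pos hr
  have hH : 0 < Kerr.scalarH M a (E4.ofTimeSpace t y) := by
    rw [Kerr.scalarH_ofTimeSpace_eq t hr]
    positivity
  rw [capConormal_timeVector hn hr]
  positivity

end Conormal

/-! ### The sign of `Σ g⁻¹(n, n) = −Σp² + q²(r² + a²) − 2Mr(p + q)²` -/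

section Sign

/-- **Black-hole zone.** If `Δ(r) = r² − 2Mr + a² < 0` (i.e. `r₋ < r < r₊`), `p, q ≥ 0` not both `0`,
`Σ > 0`, `M ≥ 0`, `r > 0`, then `−Σp² + q²(r² + a²) − 2Mr(p + q)² = −(Σ + 2Mr)p² + Δq² − 4Mr·pq < 0`:
every causal direction is allowed for the slope there (`dt*` and `dr` are both spacelike-conormals inside
the hole). [cite: arXiv08110354, §5.1] -/
theorem capConormalNum_neg_of_delta_neg {M a r S p q : ℝ} (hM : 0 ≤ M) (hr : 0 < r) (hS : 0 < S)
    (hp : 0 ≤ p) (hq : 0 ≤ q) (hpq : 0 < p + q) (hΔ : r ^ 2 - 2 * M * r + a ^ 2 < 0) :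
    -S * p ^ 2 + q ^ 2 * (r ^ 2 + a ^ 2) - 2 * M * r * (p + q) ^ 2 < 0 := by
  have key : -S * p ^ 2 + q ^ 2 * (r ^ 2 + a ^ 2) - 2 * M * r * (p + q) ^ 2 =
      -(S + 2 * M * r) * p ^ 2 + (r ^ 2 - 2 * M * r + a ^ 2) * q ^ 2 - 4 * M * r * (p * q) := by ring
  rw [key]
  have h3 : 0 ≤ 4 * M * r * (p * q) := by positivity
  rcases hp.eq_or_lt with hp0 | hp0
  · subst hp0
    have hq0 : 0 < q := by simpa using hpq
    have h2 : (r ^ 2 - 2 * M * r + a ^ 2) * q ^ 2 < 0 := mul_neg_of_neg_of_pos hΔ (by positivity)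
    nlinarith
  · have h1 : -(S + 2 * M * r) * p ^ 2 < 0 := by
      have : 0 < (S + 2 * M * r) * p ^ 2 := by positivity
      linarith
    have h2 : (r ^ 2 - 2 * M * r + a ^ 2) * q ^ 2 ≤ 0 := mul_nonpos_of_nonpos_of_nonneg hΔ.le (sq_nonneg q)
    linarith

open Summit.FinalStateConjecture.FinalStateConjecture.Theorems.KerrShieldedDataExist in
/-- **Graph zone.** If `q = T′p` with `T′ = Negative.bentSlope M a r` the slope of the crux's bent height,
`p > 0`, `r² ≤ Σ`, then `−Σp² + q²(r² + a²) − 2Mr(p + q)² = p²(−Σ + T′²(r² + a²) − 2Mr(1 + T′)²)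
≤ p² · conormalForm M a r 0 T′ < 0` (the landed certificate `Negative.conormalForm_bentSlope_neg`). [cite: arXiv08110354, §5.1] -/
theorem capConormalNum_neg_of_slope {M a r S p q : ℝ} (h : |a| < M) (hr : 0 < r) (hSr : r ^ 2 ≤ S)
    (hp : 0 < p) (hq : q = Negative.bentSlope M a r * p) :
    -S * p ^ 2 + q ^ 2 * (r ^ 2 + a ^ 2) - 2 * M * r * (p + q) ^ 2 < 0 := by
  have hneg := Negative.conormalForm_bentSlope_neg h hr 0
  unfold Negative.conormalForm at hneg
  set T := Negative.bentSlope M a r with hT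
  have key : -S * p ^ 2 + q ^ 2 * (r ^ 2 + a ^ 2) - 2 * M * r * (p + q) ^ 2 =
      p ^ 2 * (-(r ^ 2 + a ^ 2 * 0 ^ 2) + T ^ 2 * (r ^ 2 + a ^ 2) - 2 * M * r * (1 + T) ^ 2) -
        p ^ 2 * (S - r ^ 2) := by
    rw [hq]; ring
  rw [key]
  have hp2 : 0 < p ^ 2 := by positivity
  nlinarith [mul_neg_of_pos_of_neg hp2 hneg, mul_nonneg hp2.le (sub_nonneg.2 hSr)]

end Sign

/-! ### Smoothness of the spatial gradient `∇r` -/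

/-- **`∇r = (r² y + a² z e_z)/(rΣ)` is `C^n` (every `n`) wherever `r(0, y) > 0`** (`r` is `C^n` there,
`Kerr.contDiffAt_radius_slice`; `Σ = 2r² − ‖y‖² + a² > 0`). [cite: arXiv07060622, (35)] -/
theorem contDiffAt_radiusGradVec {a : ℝ} {y : E3} (hr : 0 < Kerr.radius a (E4.ofTimeSpace 0 y))
    {n : WithTop ℕ∞} : ContDiffAt ℝ n (Kerr.radiusGradVec a) y := by
  have hrad : ContDiffAt ℝ n (fun y : E3 ↦ Kerr.radius a (E4.ofTimeSpace 0 y)) y :=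
    Kerr.contDiffAt_radius_slice hr
  have hSig : ContDiffAt ℝ n (Kerr.blSigma a) y := by
    have : Kerr.blSigma a = fun y : E3 ↦ 2 * Kerr.radius a (E4.ofTimeSpace 0 y) ^ 2 - ‖y‖ ^ 2 + a ^ 2 := rfl
    rw [this]
    exact ((contDiffAt_const.mul (hrad.pow 2)).sub (contDiff_norm_sq ℝ).contDiffAt).add contDiffAt_const
  have h2 : ContDiffAt ℝ n (fun y : E3 ↦ y 2) y := contDiffAt_piLp_apply (𝕜 := ℝ) 2
  have hne : Kerr.radius a (E4.ofTimeSpace 0 y) * Kerr.blSigma a y ≠ 0 :=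
    mul_ne_zero hr.ne' (Kerr.blSigma_pos hr).ne'
  have : Kerr.radiusGradVec a = fun y : E3 ↦ (Kerr.radius a (E4.ofTimeSpace 0 y) * Kerr.blSigma a y)⁻¹ •
      (Kerr.radius a (E4.ofTimeSpace 0 y) ^ 2 • y + (a ^ 2 * y 2) • EuclideanSpace.single 2 1) := rfl
  rw [this]
  exact ((hrad.mul hSig).inv hne).smul (((hrad.pow 2).smul contDiffAt_id).add
    ((contDiffAt_const.mul h2).smul contDiffAt_const))

end KerrCap

/-- **Registered export of this file** (sub-goal `cap_conormalSquare` of stub `stub_capImmersion`): the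
`g⁻¹`-square of the cap conormal `p dt* − q dr`, `KerrCap.capConormal_coSharp`. [cite: KerrSchild1965, §2] -/
theorem cap_conormalSquare :
    ∀ {M a t p q : ℝ} {y : E3} {n : E4 →ₗ[ℝ] ℝ}, (∀ w, n w = p * w 0 - q * Kerr.radiusGrad a y (E4.spatial w)) → 0 < Kerr.radius a (E4.ofTimeSpace 0 y) → n (Kerr.coSharp M a (E4.ofTimeSpace t y) n) = (-Kerr.blSigma a y * p ^ 2 + q ^ 2 * (Kerr.radius a (E4.ofTimeSpace 0 y) ^ 2 + a ^ 2) - 2 * M * Kerr.radius a (E4.ofTimeSpace 0 y) * (p + q) ^ 2) / Kerr.blSigma a y :=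
  fun hn hr ↦ KerrCap.capConormal_coSharp hn hr

end Summit.FinalStateConjecture.FinalStateConjecture.Theorems.SwallowTheDatum

end
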